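import Mathlib
import HarnessLib
import Summits.ValiantsHypothesis.ValiantsHypothesis.Theorems.KPlusLogSqLawWeakLiftingTowerGraftWronskianKFourAlternant

/-!
# Tower graft line — THE ALTERNANT LAW IS EQUIVALENT TO CONJECTURE W AT `K = 4` ON THE ORIENTATION `d₀ + d₃ < d₁ + d₂` (converse)

Helper file for LINE (B) `Cruxes/WeakLifting/Lines/tower_graft.lean` (crux `WeakLifting` = stmt-ValiantsHypothesis-19561), on the located
target (W-4) = `ConjectureWAt 4`.  NO stub is claimed; `ConjectureWAt 4` stays OPEN.

`…WronskianKFourAlternant` (this hand, p829974) showed: five positive zeros of `W(u,v)` force the ALTERNANT IDENTITY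
`A₁A₄·w₁w₃ = A₀A₅·w₂w₃ + A₂A₃·w₁w₂` at the zero set.  This file proves the CONVERSE, so that the reduction is exact:

* ★★ `five_le_of_alternant_identity` — if `0 < r₀ < ⋯ < r₄` and a support `d` (orientation `d₀ + d₃ < d₁ + d₂`) satisfy the alternant
  identity, then the explicit pair `u = (1, 0, −p₁₂/p₀₁, −p₁₃/p₀₁)`, `v = (0, p₀₁, p₀₂, p₀₃)` with
  `(p₀₁, p₀₂, p₀₃, p₁₂, p₁₃, p₂₃) = (A₀/δ₀₁, −A₁/δ₀₂, A₂/δ₀₃, −A₃/δ₁₂, A₄/δ₁₃, −A₅/δ₂₃)` (`δ_{ab} = d_b − d_a`; the identity is exactly the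
  Plücker relation of these six numbers) has `W(u,v)(r_m) = 0` for all `m`, hence `Z₊(W(u,v)) ≥ 5`;
* ★★ `alternantLaw_iff_orientA` — ALTERNANT LAW («the identity never holds») `⟺` «`Z₊(W(u,v)) ≤ 4` for all real `4`-nomial pairs on every
  support with `d₀ + d₃ < d₁ + d₂`» (and the latter is equivalent to `ConjectureWAt 4` by the g10–g11 cell/reflection reductions).

So a kit search for a zero of `A₁A₄·w₁w₃ − A₀A₅·w₂w₃ − A₂A₃·w₁w₂` on five-point configurations IS a search for a counterexample to Conjecture W
at `K = 4`, and a proof of its sign is a proof of it.  HONEST FRAMING: a reformulation; nothing on S4/S4f/S5/S5ᴸ, TowerB, `WeakLifting`,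
Conjecture B, `MatrixDescartes` (18050), `VP ≠ VNP`.  Def-free.  Seat: prover leafhand-val-kpluslogsqlaw-1 g12, `--supports
stmt-ValiantsHypothesis-19561 --as helper`.  [this work]
-/

-- `Summit.ValiantsHypothesis.ValiantsHypothesis.…` repeats a component by the D-0017 layout
-- (single-conjunct summit), which the `dupNamespace` linter flags; the name is mandated.
set_option linter.dupNamespace false
set_option autoImplicit false

namespace Summit.ValiantsHypothesis.ValiantsHypothesis.Theorems.KPlusLogSqLaw.TowerGraft

open Polynomial Finset
open scoped BigOperators Polynomial
open Literature.LinearAlgebra.Matrix.GeneralizedVandermonde (genVandermonde genVandermonde_apply det_genVandermonde_pos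
  det_genVandermonde_ne_zero)

namespace WronskianDevelopable

/-- ★★ **CONVERSE: an alternant identity produces five zeros.** [this work] -/
theorem five_le_of_alternant_identity (r : Fin 5 → ℝ) (hr : StrictMono r) (hr0 : ∀ m, 0 < r m) (d : Fin 4 → ℕ)
    (hd : StrictMono d) (hA : d 0 + d 3 < d 1 + d 2)
    (hid : (genVandermonde r ![d 0 + d 1, d 0 + d 3, d 1 + d 2, d 1 + d 3, d 2 + d 3]).det *
          (genVandermonde r ![d 0 + d 1, d 0 + d 2, d 0 + d 3, d 1 + d 2, d 2 + d 3]).det *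
          ((((d 1 : ℝ) - d 0) * ((d 3 : ℝ) - d 2)) * (((d 3 : ℝ) - d 0) * ((d 2 : ℝ) - d 1))) =
        (genVandermonde r ![d 0 + d 2, d 0 + d 3, d 1 + d 2, d 1 + d 3, d 2 + d 3]).det *
            (genVandermonde r ![d 0 + d 1, d 0 + d 2, d 0 + d 3, d 1 + d 2, d 1 + d 3]).det *
            ((((d 2 : ℝ) - d 0) * ((d 3 : ℝ) - d 1)) * (((d 3 : ℝ) - d 0) * ((d 2 : ℝ) - d 1))) +
          (genVandermonde r ![d 0 + d 1, d 0 + d 2, d 1 + d 2, d 1 + d 3, d 2 + d 3]).det *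
            (genVandermonde r ![d 0 + d 1, d 0 + d 2, d 0 + d 3, d 1 + d 3, d 2 + d 3]).det *
            ((((d 1 : ℝ) - d 0) * ((d 3 : ℝ) - d 2)) * (((d 2 : ℝ) - d 0) * ((d 3 : ℝ) - d 1)))) :
    ∃ u v : Fin 4 → ℝ,
      (∀ m, (wronskian (∑ l, C (u l) * (X : ℝ[X]) ^ d l) (∑ l, C (v l) * (X : ℝ[X]) ^ d l)).IsRoot (r m)) ∧
      5 ≤ ((wronskian (∑ l, C (u l) * (X : ℝ[X]) ^ d l) (∑ l, C (v l) * (X : ℝ[X]) ^ d l)).roots.toFinset.filter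
        (fun x => 0 < x)).card := by
  classical
  -- abbreviations
  set A0 := (genVandermonde r ![d 0 + d 2, d 0 + d 3, d 1 + d 2, d 1 + d 3, d 2 + d 3]).det with hA0
  set A1 := (genVandermonde r ![d 0 + d 1, d 0 + d 3, d 1 + d 2, d 1 + d 3, d 2 + d 3]).det with hA1
  set A2 := (genVandermonde r ![d 0 + d 1, d 0 + d 2, d 1 + d 2, d 1 + d 3, d 2 + d 3]).det with hA2
  set A3 := (genVandermonde r ![d 0 + d 1, d 0 + d 2, d 0 + d 3, d 1 + d 3, d 2 + d 3]).det with hA3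
  set A4 := (genVandermonde r ![d 0 + d 1, d 0 + d 2, d 0 + d 3, d 1 + d 2, d 2 + d 3]).det with hA4
  set A5 := (genVandermonde r ![d 0 + d 1, d 0 + d 2, d 0 + d 3, d 1 + d 2, d 1 + d 3]).det with hA5
  have h01 : (d 0 : ℝ) < d 1 := by exact_mod_cast hd (show (0 : Fin 4) < 1 by decide)
  have h02 : (d 0 : ℝ) < d 2 := by exact_mod_cast hd (show (0 : Fin 4) < 2 by decide)
  have h03 : (d 0 : ℝ) < d 3 := by exact_mod_cast hd (show (0 : Fin 4) < 3 by decide)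
  have h12 : (d 1 : ℝ) < d 2 := by exact_mod_cast hd (show (1 : Fin 4) < 2 by decide)
  have h13 : (d 1 : ℝ) < d 3 := by exact_mod_cast hd (show (1 : Fin 4) < 3 by decide)
  have h23 : (d 2 : ℝ) < d 3 := by exact_mod_cast hd (show (2 : Fin 4) < 3 by decide)
  obtain ⟨hA0p, -, -, -, -, -⟩ := alternant_minors_pos r hr hr0 d hd hA
  -- Plücker coordinates
  set p01 : ℝ := A0 / ((d 1 : ℝ) - d 0) with hp01
  set p02 : ℝ := -A1 / ((d 2 : ℝ) - d 0) with hp02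
  set p03 : ℝ := A2 / ((d 3 : ℝ) - d 0) with hp03
  set p12 : ℝ := -A3 / ((d 2 : ℝ) - d 1) with hp12
  set p13 : ℝ := A4 / ((d 3 : ℝ) - d 1) with hp13
  set p23 : ℝ := -A5 / ((d 3 : ℝ) - d 2) with hp23
  have hp01pos : 0 < p01 := div_pos hA0p (sub_pos.mpr h01)
  have hne01 : ((d 1 : ℝ) - d 0) ≠ 0 := (sub_pos.mpr h01).ne'
  have hne02 : ((d 2 : ℝ) - d 0) ≠ 0 := (sub_pos.mpr h02).ne'
  have hne03 : ((d 3 : ℝ) - d 0) ≠ 0 := (sub_pos.mpr h03).ne'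
  have hne12 : ((d 2 : ℝ) - d 1) ≠ 0 := (sub_pos.mpr h12).ne'
  have hne13 : ((d 3 : ℝ) - d 1) ≠ 0 := (sub_pos.mpr h13).ne'
  have hne23 : ((d 3 : ℝ) - d 2) ≠ 0 := (sub_pos.mpr h23).ne'
  -- the alternant identity is the Plücker relation of the `p`'s
  have plucker : p01 * p23 - p02 * p13 + p03 * p12 = 0 := by
    rw [hp01, hp02, hp03, hp12, hp13, hp23]
    field_simp
    linear_combination hid
  -- the pair `u, v`
  set u : Fin 4 → ℝ := ![1, 0, -p12 / p01, -p13 / p01] with hu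
  set v : Fin 4 → ℝ := ![0, p01, p02, p03] with hv
  have m01 : u 0 * v 1 - u 1 * v 0 = p01 := by simp [hu, hv]
  have m02 : u 0 * v 2 - u 2 * v 0 = p02 := by simp [hu, hv]
  have m03 : u 0 * v 3 - u 3 * v 0 = p03 := by simp [hu, hv]
  have m12 : u 1 * v 2 - u 2 * v 1 = p12 := by
    simp [hu, hv]; field_simp
  have m13 : u 1 * v 3 - u 3 * v 1 = p13 := by
    simp [hu, hv]; field_simp
  have m23 : u 2 * v 3 - u 3 * v 2 = p23 := by
    simp [hu, hv]
    field_simp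
    linear_combination (-1 : ℝ) * plucker
  -- the six coefficients of `X·W(u,v)` are `(−1)^t A_t`
  have c0 : (u 0 * v 1 - u 1 * v 0) * ((d 1 : ℝ) - d 0) = A0 := by rw [m01, hp01]; field_simp
  have c1 : (u 0 * v 2 - u 2 * v 0) * ((d 2 : ℝ) - d 0) = -A1 := by rw [m02, hp02]; field_simp
  have c2 : (u 0 * v 3 - u 3 * v 0) * ((d 3 : ℝ) - d 0) = A2 := by rw [m03, hp03]; field_simp
  have c3 : (u 1 * v 2 - u 2 * v 1) * ((d 2 : ℝ) - d 1) = -A3 := by rw [m12, hp12]; field_simp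
  have c4 : (u 1 * v 3 - u 3 * v 1) * ((d 3 : ℝ) - d 1) = A4 := by rw [m13, hp13]; field_simp
  have c5 : (u 2 * v 3 - u 3 * v 2) * ((d 3 : ℝ) - d 2) = -A5 := by rw [m23, hp23]; field_simp
  set W : ℝ[X] := wronskian (∑ l, C (u l) * (X : ℝ[X]) ^ d l) (∑ l, C (v l) * (X : ℝ[X]) ^ d l) with hW
  -- the cofactor identity gives `(X·W)(r_m) = 0`
  set e : Fin 6 → ℕ := ![d 0 + d 1, d 0 + d 2, d 0 + d 3, d 1 + d 2, d 1 + d 3, d 2 + d 3] with he_def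
  set G : Matrix (Fin 6) (Fin 5) ℝ := Matrix.of fun t m => r m ^ e t with hG
  have hsubG : ∀ t : Fin 6, G.submatrix t.succAbove id = genVandermonde r (e ∘ t.succAbove) := by
    intro t; ext a b; simp [hG, genVandermonde_apply]
  have s0 : (e ∘ (0 : Fin 6).succAbove) = ![d 0 + d 2, d 0 + d 3, d 1 + d 2, d 1 + d 3, d 2 + d 3] := by
    funext j; fin_cases j <;> rfl
  have s1 : (e ∘ (1 : Fin 6).succAbove) = ![d 0 + d 1, d 0 + d 3, d 1 + d 2, d 1 + d 3, d 2 + d 3] := by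
    funext j; fin_cases j <;> rfl
  have s2 : (e ∘ (2 : Fin 6).succAbove) = ![d 0 + d 1, d 0 + d 2, d 1 + d 2, d 1 + d 3, d 2 + d 3] := by
    funext j; fin_cases j <;> rfl
  have s3 : (e ∘ (3 : Fin 6).succAbove) = ![d 0 + d 1, d 0 + d 2, d 0 + d 3, d 1 + d 3, d 2 + d 3] := by
    funext j; fin_cases j <;> rfl
  have s4 : (e ∘ (4 : Fin 6).succAbove) = ![d 0 + d 1, d 0 + d 2, d 0 + d 3, d 1 + d 2, d 2 + d 3] := by
    funext j; fin_cases j <;> rfl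
  have s5 : (e ∘ (5 : Fin 6).succAbove) = ![d 0 + d 1, d 0 + d 2, d 0 + d 3, d 1 + d 2, d 1 + d 3] := by
    funext j; fin_cases j <;> rfl
  have hroot : ∀ m, W.IsRoot (r m) := by
    intro m
    have hcof : ∑ t : Fin 6, ((-1 : ℝ) ^ (t : ℕ) * (G.submatrix t.succAbove id).det) * G t m = 0 :=
      cofactor_sum_eq_zero G m
    simp only [Fin.sum_univ_six, hsubG] at hcof
    rw [s0, s1, s2, s3, s4, s5, ← hA0, ← hA1, ← hA2, ← hA3, ← hA4, ← hA5] at hcof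
    simp only [hG, Matrix.of_apply, Fin.val_zero, Fin.val_one, pow_zero, pow_one, one_mul] at hcof
    norm_num at hcof
    have hev := eval_X_mul_wronskian_four u v d (r m)
    rw [c0, c1, c2, c3, c4, c5] at hev
    simp only [Fin.sum_univ_six, Matrix.cons_val_zero, Matrix.cons_val_one, Matrix.cons_val] at hev
    have hXW : ((X : ℝ[X]) * W).eval (r m) = 0 := by
      rw [hW, hev]
      simp only [he_def, Matrix.cons_val_zero, Matrix.cons_val_one, Matrix.cons_val] at hcof
      linear_combination hcof
    rw [eval_mul, eval_X] at hXW
    rcases mul_eq_zero.mp hXW with h | h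
    · exact absurd h (hr0 m).ne'
    · exact h
  -- `W ≠ 0`: the coefficient of `X·W` at `X^{d₀+d₁}` is `A₀ ≠ 0`
  have hd01 : d 0 < d 1 := hd (by decide)
  have hd12 : d 1 < d 2 := hd (by decide)
  have hd23 : d 2 < d 3 := hd (by decide)
  have hW0 : W ≠ 0 := by
    intro h0
    have hc : ((X : ℝ[X]) * W).coeff (d 0 + d 1) = 0 := by rw [h0, mul_zero, coeff_zero]
    rw [hW, X_mul_wronskian_four_eq, c0, c1, c2, c3, c4, c5] at hc
    simp only [coeff_add, coeff_C_mul, coeff_X_pow] at hc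
    have n1 : d 0 + d 1 ≠ d 0 + d 2 := by omega
    have n2 : d 0 + d 1 ≠ d 0 + d 3 := by omega
    have n3 : d 0 + d 1 ≠ d 1 + d 2 := by omega
    have n4 : d 0 + d 1 ≠ d 1 + d 3 := by omega
    have n5 : d 0 + d 1 ≠ d 2 + d 3 := by omega
    simp only [n1, n2, n3, n4, n5, if_true, if_false, mul_one, mul_zero, add_zero] at hc
    exact hA0p.ne' hc
  refine ⟨u, v, hroot, ?_⟩
  -- the five distinct positive roots
  have hsub : Finset.univ.image r ⊆ W.roots.toFinset.filter (fun x => 0 < x) := by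
    intro x hx
    obtain ⟨m, -, rfl⟩ := Finset.mem_image.mp hx
    exact Finset.mem_filter.mpr ⟨Multiset.mem_toFinset.mpr ((mem_roots hW0).mpr (hroot m)), hr0 m⟩
  have hcard : (Finset.univ.image r).card = 5 := by
    rw [Finset.card_image_of_injective _ hr.injective]; simp
  exact hcard ▸ Finset.card_le_card hsub

/-- ★★ **THE ALTERNANT LAW IS EQUIVALENT TO CONJECTURE W AT `K = 4` ON THE ORIENTATION `d₀ + d₃ < d₁ + d₂`.** [this work] -/
theorem alternantLaw_iff_orientA :
    (∀ (r : Fin 5 → ℝ), StrictMono r → (∀ m, 0 < r m) → ∀ (d : Fin 4 → ℕ), StrictMono d → d 0 + d 3 < d 1 + d 2 →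
      (genVandermonde r ![d 0 + d 1, d 0 + d 3, d 1 + d 2, d 1 + d 3, d 2 + d 3]).det *
          (genVandermonde r ![d 0 + d 1, d 0 + d 2, d 0 + d 3, d 1 + d 2, d 2 + d 3]).det *
          ((((d 1 : ℝ) - d 0) * ((d 3 : ℝ) - d 2)) * (((d 3 : ℝ) - d 0) * ((d 2 : ℝ) - d 1))) ≠
        (genVandermonde r ![d 0 + d 2, d 0 + d 3, d 1 + d 2, d 1 + d 3, d 2 + d 3]).det *
            (genVandermonde r ![d 0 + d 1, d 0 + d 2, d 0 + d 3, d 1 + d 2, d 1 + d 3]).det *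
            ((((d 2 : ℝ) - d 0) * ((d 3 : ℝ) - d 1)) * (((d 3 : ℝ) - d 0) * ((d 2 : ℝ) - d 1))) +
          (genVandermonde r ![d 0 + d 1, d 0 + d 2, d 1 + d 2, d 1 + d 3, d 2 + d 3]).det *
            (genVandermonde r ![d 0 + d 1, d 0 + d 2, d 0 + d 3, d 1 + d 3, d 2 + d 3]).det *
            ((((d 1 : ℝ) - d 0) * ((d 3 : ℝ) - d 2)) * (((d 2 : ℝ) - d 0) * ((d 3 : ℝ) - d 1)))) ↔
    (∀ (u v : Fin 4 → ℝ) (d : Fin 4 → ℕ), StrictMono d → d 0 + d 3 < d 1 + d 2 →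
      ((wronskian (∑ l, C (u l) * (X : ℝ[X]) ^ d l) (∑ l, C (v l) * (X : ℝ[X]) ^ d l)).roots.toFinset.filter
        (fun x => 0 < x)).card ≤ 4) := by
  constructor
  · intro AL u v d hd hA
    exact card_posRoots_wronskian_four_le_four_of_alternantLaw_orient AL u v d hd hA
  · intro H r hr hr0 d hd hA hid
    obtain ⟨u, v, -, h5⟩ := five_le_of_alternant_identity r hr hr0 d hd hA hid
    have := H u v d hd hA
    omega

end WronskianDevelopable

end Summit.ValiantsHypothesis.ValiantsHypothesis.Theorems.KPlusLogSqLaw.TowerGraft
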